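import Literature.AlgebraicGeometry.Resolution.AlterationsFormalCoordinates
import Literature.AlgebraicGeometry.Resolution.AlterationsNodeLocalStructure
import Literature.AlgebraicGeometry.Resolution.AlterationsNormalFormBlowupChartsFormal
import Mathlib.RingTheory.MvPowerSeries.Substitution
import Mathlib.RingTheory.MvPowerSeries.Trunc
import HarnessLib

/-!
# Cohen coordinates linear over the ground field; maps of complete local rings in coordinates

Topic: `Summits/ResolutionOfSingularities/ResolutionOfSingularities/Theorems`. Helpers (part 1 of 3) for
the stub `stub_formalChart` (formal-chart package) of the line `support-first-weights-second` of the crux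
`Theses.WeightedInvariant.WeightedConstruction` (statement `stmt-ResolutionOfSingularities-0571`):

* `exists_ringEquiv_adicCompletion_mvPowerSeries_linear` — Cohen's structure theorem for a regular local
  ring `B` with a field of representatives `φ : K → B` (`K → B → B/𝔪` onto): `B̂ ≃ K⟦X₁, …, X_d⟧` taking
  generators `zᵢ` of `𝔪` to `Xᵢ`, the constants `φ a` to `C a`, and series without terms of degree `< N`
  into `𝔪̂ᴺ` (Matsumura Thm. 29.7, with the coefficient field CHOSEN as `φ(K)`; the tree's
  `exists_ringEquiv_adicCompletion_mvPowerSeries_of_rsop` does not record `K`-linearity);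
  `exists_ringEquiv_adicCompletion_stalk_mvPowerSeries_linear` — the same at a regular closed point of a
  scheme locally of finite type over an algebraically closed field, for the constants
  `k = Γ(Spec k) → Γ(X) → 𝒪_{X,x}` (`κ(x) = k`, `residue_comp_const_surjective`);
* `ringEquiv_map_eq_subst` — a local homomorphism of complete local rings is, in such coordinates, the
  substitution determined by its values on the constants and on the parameters;
* `stalkMap_const`, `map_maximalIdeal_completedStalkMap_le` — stalk maps preserve constants; the completed
  stalk map is local.

## Sources

* H. Matsumura, *Commutative Ring Theory*, CUP 1986, Thm. 29.7 and the proof of Thm. 29.4. [Matsumura1987]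
* The Stacks Project, Tag 0CY7 (residue fields of closed points over algebraically closed fields).
-/

noncomputable section

open CategoryTheory CategoryTheory.Limits AlgebraicGeometry TopologicalSpace
open Literature.AlgebraicGeometry.Resolution IsLocalRing
open scoped LaurentPolynomial

-- the summit namespace repeats `ResolutionOfSingularities` by design
set_option linter.dupNamespace false

namespace Summit.ResolutionOfSingularities.ResolutionOfSingularities.Theorems

universe u

/-! ## Cohen coordinates, linear over a field of representatives -/

/-- **Cohen coordinates linear over a field of representatives.** Let `B` be a regular local ring of
dimension `d`, `φ : K → B` a ring map from a field whose composite with the residue map is surjective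
(so `φ(K)` is a field of representatives), and `z₁, …, z_d` generators of `𝔪`. Then there is a ring
isomorphism `e : B̂ ≃ K⟦X₁, …, X_d⟧` of the `𝔪`-adic completion with `e(zᵢ) = Xᵢ`, `e(φ a) = C a`, and
under which a power series without terms of total degree `< N` corresponds to an element of `𝔪̂ᴺ`
(Matsumura, Thm. 29.7 with the proof of Thm. 29.4, the coefficient field being `φ(K)`: the expansion map
`K⟦X⟧ → B̂`, `Xᵢ ↦ zᵢ`, coefficients through `φ`, is bijective, `comp_map_bijective`).
[cite: Matsumura1987, Thm. 29.7] -/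
theorem exists_ringEquiv_adicCompletion_mvPowerSeries_linear (B : Type u) [CommRing B]
    [IsRegularLocalRing B] {K : Type u} [Field K] (φ : K →+* B)
    (hφ : Function.Surjective ((residue B).comp φ)) {d : ℕ} (z : Fin d → B)
    (hz : Ideal.span (Set.range z) = maximalIdeal B) (hd : ringKrullDim B = d) :
    ∃ e : AdicCompletion (maximalIdeal B) B ≃+* MvPowerSeries (Fin d) K,
      (∀ i, e (algebraMap B (AdicCompletion (maximalIdeal B) B) (z i)) = MvPowerSeries.X i) ∧
      (∀ a, e (algebraMap B (AdicCompletion (maximalIdeal B) B) (φ a)) = MvPowerSeries.C a) ∧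
      ∀ (N : ℕ) (G : MvPowerSeries (Fin d) K),
        (∀ x : Fin d →₀ ℕ, x.degree < N → MvPowerSeries.coeff x G = 0) →
          e.symm G ∈ maximalIdeal (AdicCompletion (maximalIdeal B) B) ^ N := by
  set A := AdicCompletion (maximalIdeal B) B with hA
  haveI : IsRegularLocalRing A := isRegularLocalRing_adicCompletion B
  -- `K → B̂ → B̂/𝔪̂` is bijective: `φ(K)` is a field of representatives of `B̂`
  let θ : K →+* ResidueField A := (residue A).comp ((algebraMap B A).comp φ)
  have hθ : Function.Bijective θ := by
    refine ⟨θ.injective, fun x => ?_⟩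
    obtain ⟨y, hy⟩ := (AdicCompletion.residueField_map_bijective B).2 x
    obtain ⟨b₀, rfl⟩ := residue_surjective y
    obtain ⟨c, hc⟩ := hφ (residue B b₀)
    refine ⟨c, ?_⟩
    rw [← hy, show residue B b₀ = residue B (φ c) from hc.symm, ResidueField.map_residue]
    rfl
  let θE : K ≃+* ResidueField A := RingEquiv.ofBijective θ hθ
  -- the section `σ` of the residue map of `B̂` with image `φ(K)`
  let σ : ResidueField A →+* A := ((algebraMap B A).comp φ).comp θE.symm.toRingHom
  have hσ : ∀ c, residue A (σ c) = c := fun c => by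
    change θ (θE.symm c) = c
    exact θE.apply_symm_apply c
  have hσθ : ∀ a : K, σ (θE a) = algebraMap B A (φ a) := fun a => by
    change algebraMap B A (φ (θE.symm (θE a))) = _
    rw [θE.symm_apply_apply]
  -- the regular system of parameters `z` of `B̂`
  let z' : Fin d → A := fun i => algebraMap B A (z i)
  have hmax : maximalIdeal A = (maximalIdeal B).map (algebraMap B A) :=
    AdicCompletion.maximalIdeal_eq_map
  have hz' : Ideal.span (Set.range z') = maximalIdeal A := by
    have h1 : (Ideal.span (Set.range z)).map (algebraMap B A) = Ideal.span (Set.range z') := by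
      rw [Ideal.map_span, ← Set.range_comp]
      rfl
    rw [← h1, congrArg (Ideal.map (algebraMap B A)) hz]
    exact hmax.symm
  have hz'm : ∀ i, z' i ∈ maximalIdeal A := fun i => hz' ▸ Ideal.subset_span ⟨i, rfl⟩
  have hd' : (maximalIdeal A).spanFinrank = d := by
    rw [AdicCompletion.spanFinrank_maximalIdeal_eq]
    exact spanFinrank_maximalIdeal_eq_of_ringKrullDim_eq hd
  -- the expansion map `K⟦X⟧ → B̂`, `Xᵢ ↦ zᵢ`, coefficients through `σ`, is bijective
  obtain ⟨Φ, hΦ₁, hΦ₂⟩ := exists_adicEvalHom (maximalIdeal A) z' hz'm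
  have hbij := comp_map_bijective σ hσ hd' z' hz' Φ hΦ₁ hΦ₂
  let e₀ : A ≃+* MvPowerSeries (Fin d) (ResidueField A) := (RingEquiv.ofBijective _ hbij).symm
  have he₀ : ∀ i, e₀ (z' i) = MvPowerSeries.X i := by
    intro i
    apply (RingEquiv.ofBijective _ hbij).injective
    rw [RingEquiv.apply_symm_apply, RingEquiv.ofBijective_apply, RingHom.comp_apply,
      MvPowerSeries.map_X, ← MvPolynomial.coe_X, hΦ₁, MvPolynomial.eval_X]
  have he₀C : ∀ a : K, e₀ (algebraMap B A (φ a)) = MvPowerSeries.C (θE a) := by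
    intro a
    apply (RingEquiv.ofBijective _ hbij).injective
    rw [RingEquiv.apply_symm_apply, RingEquiv.ofBijective_apply, RingHom.comp_apply,
      MvPowerSeries.map_C, ← MvPolynomial.coe_C, hΦ₁, MvPolynomial.eval_C, hσθ]
  let e₁ : MvPowerSeries (Fin d) (ResidueField A) ≃+* MvPowerSeries (Fin d) K :=
    MvPowerSeries.mapRingEquiv θE.symm
  refine ⟨e₀.trans e₁, fun i => ?_, fun a => ?_, fun N G hG => ?_⟩
  · rw [RingEquiv.trans_apply]
    change e₁ (e₀ (z' i)) = _
    rw [he₀, MvPowerSeries.mapRingEquiv_X]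
  · rw [RingEquiv.trans_apply, he₀C]
    change MvPowerSeries.map (σ := Fin d) θE.symm.toRingHom (MvPowerSeries.C (θE a)) = _
    rw [MvPowerSeries.map_C]
    change MvPowerSeries.C (θE.symm (θE a)) = _
    rw [θE.symm_apply_apply]
  · -- `e⁻¹ G = Φ (σ θE G)` has no terms of degree `< N`
    have h1 : (e₀.trans e₁).symm G =
        Φ (MvPowerSeries.map σ (MvPowerSeries.map (σ := Fin d) θE.toRingHom G)) := rfl
    rw [h1]
    refine hΦ₂ N _ fun x hx => ?_
    rw [MvPowerSeries.coeff_map, MvPowerSeries.coeff_map, hG x hx, map_zero, map_zero]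

/-- The constants `k = Γ(Spec k) → Γ(X) → 𝒪_{X,x}` of a scheme over `Spec k` are the germs of the
constant sections `sectionConst`. [folklore] -/
theorem germ_sectionConst {k : Type u} [Field k] {X : Scheme.{u}} (f : X ⟶ Spec (.of k)) {x : X}
    (V : X.Opens) (hxV : x ∈ V) (a : k) :
    (X.presheaf.germ V x hxV).hom (sectionConst f V a) =
      (X.presheaf.germ ⊤ x trivial).hom (f.appTop.hom ((Scheme.ΓSpecIso (.of k)).inv.hom a)) := by
  rw [sectionConst, RingHom.comp_apply, Scheme.Hom.appLE, CommRingCat.comp_apply,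
    TopCat.Presheaf.germ_res_apply]
  rfl

/-- **At a closed point of a scheme locally of finite type over an algebraically closed field, the
constants map onto the residue field** (`κ(x) = k`, Zariski's lemma). [cite: StacksProject, Tag 0CY7] -/
theorem residue_comp_const_surjective {k : Type u} [Field k] [IsAlgClosed k] {X : Scheme.{u}}
    (f : X ⟶ Spec (.of k)) [LocallyOfFiniteType f] {x : X} (hx : IsClosed ({x} : Set X)) :
    Function.Surjective ((residue (X.presheaf.stalk x)).comp ((X.presheaf.germ ⊤ x trivial).hom.comp
      (f.appTop.hom.comp (Scheme.ΓSpecIso (.of k)).inv.hom))) := by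
  intro r
  obtain ⟨ρ, rfl⟩ := residue_surjective r
  obtain ⟨V, hV, hxV, -⟩ :=
    exists_isAffineOpen_mem_and_subset (X := X) (x := x) (U := ⊤) (Opens.mem_top x)
  obtain ⟨l, hl⟩ := exists_sub_germ_sectionConst_mem_maximalIdeal_of_isClosed f hV hxV hx ρ
  refine ⟨l, ?_⟩
  rw [germ_sectionConst] at hl
  exact ((Ideal.Quotient.mk_eq_mk_iff_sub_mem ρ _).mpr hl).symm

/-- **Formal coordinates at a regular closed point, linear over the ground field**: for a scheme `X`
locally of finite type over an algebraically closed field `k`, a closed point `x` with `𝒪_{X,x}`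
regular of dimension `d` and generators `z₁, …, z_d` of `𝔪ₓ`, there is `e : 𝒪̂_{X,x} ≃ k⟦X₁, …, X_d⟧`
with `e(zᵢ) = Xᵢ`, `e(a) = C a` for the constants `a ∈ k`, and `e⁻¹` of a series without terms of
degree `< N` in `𝔪̂ₓᴺ` (`exists_ringEquiv_adicCompletion_mvPowerSeries_linear` with `κ(x) = k`).
[cite: Matsumura1987, Thm. 29.7] -/
theorem exists_ringEquiv_adicCompletion_stalk_mvPowerSeries_linear {k : Type u} [Field k]
    [IsAlgClosed k] {X : Scheme.{u}} (f : X ⟶ Spec (.of k)) [LocallyOfFiniteType f] {x : X}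
    (hx : IsClosed ({x} : Set X)) [IsRegularLocalRing (X.presheaf.stalk x)] {d : ℕ}
    (z : Fin d → X.presheaf.stalk x)
    (hz : Ideal.span (Set.range z) = maximalIdeal (X.presheaf.stalk x))
    (hd : ringKrullDim (X.presheaf.stalk x) = d) :
    ∃ e : AdicCompletion (maximalIdeal (X.presheaf.stalk x)) (X.presheaf.stalk x) ≃+*
        MvPowerSeries (Fin d) k,
      (∀ i, e (algebraMap _ _ (z i)) = MvPowerSeries.X i) ∧
      (∀ a : k, e (algebraMap _ _ ((X.presheaf.germ ⊤ x trivial).hom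
        (f.appTop.hom ((Scheme.ΓSpecIso (.of k)).inv.hom a)))) = MvPowerSeries.C a) ∧
      ∀ (N : ℕ) (G : MvPowerSeries (Fin d) k),
        (∀ y : Fin d →₀ ℕ, y.degree < N → MvPowerSeries.coeff y G = 0) →
          e.symm G ∈ maximalIdeal (AdicCompletion (maximalIdeal (X.presheaf.stalk x))
            (X.presheaf.stalk x)) ^ N :=
  exists_ringEquiv_adicCompletion_mvPowerSeries_linear (X.presheaf.stalk x)
    ((X.presheaf.germ ⊤ x trivial).hom.comp (f.appTop.hom.comp (Scheme.ΓSpecIso (.of k)).inv.hom))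
    (residue_comp_const_surjective f hx) z hz hd

/-! ## Identifying a map of complete local rings in formal coordinates -/

/-- **A local homomorphism of complete local rings is determined, in Cohen coordinates, by its values
on the field of representatives and on a regular system of parameters.** Let `eY : 𝒪_Y ≃ K⟦X⟧`,
`eB : 𝒪_B ≃ K⟦X'⟧` be ring isomorphisms of local rings, `eY` linear over `φ : K → 𝒪_Y`, taking `zᵢ` to
`Xᵢ` and series without terms of degree `< N` into `𝔪_Yᴺ`, and `𝒪_B` `𝔪`-adically separated. If a
local ring homomorphism `ψ : 𝒪_Y → 𝒪_B` takes the constants `φ(a)` to `C a` and the `zᵢ` to `Fᵢ`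
(`Fᵢ ∈ 𝔪`), then in coordinates `ψ` IS the substitution `Xᵢ ↦ Fᵢ`: both agree on the dense subring
`K[z]` and are `𝔪`-adically continuous. [folklore] -/
theorem ringEquiv_map_eq_subst {K : Type u} [Field K] {OY OB : Type u} [CommRing OY] [IsLocalRing OY]
    [CommRing OB] [IsLocalRing OB] [IsHausdorff (maximalIdeal OB) OB] {d d' : ℕ}
    (eY : OY ≃+* MvPowerSeries (Fin d) K) (eB : OB ≃+* MvPowerSeries (Fin d') K)
    (F : Fin d → MvPowerSeries (Fin d') K) (hF : ∀ i, MvPowerSeries.constantCoeff (F i) = 0)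
    (φ : K →+* OY) (hφ : ∀ a, eY (φ a) = MvPowerSeries.C a)
    (z : Fin d → OY) (hz : ∀ i, eY (z i) = MvPowerSeries.X i)
    (happrox : ∀ (N : ℕ) (G : MvPowerSeries (Fin d) K),
      (∀ x : Fin d →₀ ℕ, x.degree < N → MvPowerSeries.coeff x G = 0) → eY.symm G ∈ maximalIdeal OY ^ N)
    (ψ : OY →+* OB) (hψ : (maximalIdeal OY).map ψ ≤ maximalIdeal OB)
    (hψc : ∀ a, eB (ψ (φ a)) = MvPowerSeries.C a) (hψz : ∀ i, eB (ψ (z i)) = F i) (a : OY) :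
    eB (ψ a) = MvPowerSeries.subst F (eY a) := by
  have hFs : MvPowerSeries.HasSubst F := MvPowerSeries.hasSubst_of_constantCoeff_zero hF
  -- the substitution, read back in `𝒪_B`
  let Φ : OY →+* OB := eB.symm.toRingHom.comp
    ((MvPowerSeries.substAlgHom (R := K) hFs).toRingHom.comp eY.toRingHom)
  have hΦ : ∀ x, eB (Φ x) = MvPowerSeries.subst F (eY x) := fun x => by
    change eB (eB.symm (MvPowerSeries.substAlgHom hFs (eY x))) = _
    rw [RingEquiv.apply_symm_apply, MvPowerSeries.substAlgHom_apply]
  suffices h : ψ a = Φ a by rw [h, hΦ]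
  -- units of power series rings are the series with non-zero constant coefficient
  have hmax : ∀ {e : ℕ} (G : MvPowerSeries (Fin e) K),
      G ∈ maximalIdeal (MvPowerSeries (Fin e) K) ↔ MvPowerSeries.constantCoeff G = 0 := fun G => by
    rw [IsLocalRing.mem_maximalIdeal, mem_nonunits_iff, MvPowerSeries.isUnit_iff_constantCoeff,
      isUnit_iff_ne_zero, not_not]
  have hunitY : ∀ x : OY, IsUnit (eY x) ↔ IsUnit x :=
    fun x => ⟨fun h => by simpa using h.map eY.symm, fun h => h.map eY⟩
  have hunitB : ∀ x : MvPowerSeries (Fin d') K, IsUnit (eB.symm x) ↔ IsUnit x :=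
    fun x => ⟨fun h => by simpa using h.map eB, fun h => h.map eB.symm⟩
  -- `Φ` is a local homomorphism
  have hΦloc : (maximalIdeal OY).map Φ ≤ maximalIdeal OB := by
    rw [Ideal.map_le_iff_le_comap]
    intro x hx
    rw [Ideal.mem_comap, IsLocalRing.mem_maximalIdeal, mem_nonunits_iff]
    change ¬ IsUnit (eB.symm (MvPowerSeries.substAlgHom hFs (eY x)))
    rw [hunitB, MvPowerSeries.substAlgHom_apply, ← mem_nonunits_iff, ← IsLocalRing.mem_maximalIdeal,
      hmax]
    refine MvPowerSeries.constantCoeff_subst_eq_zero hFs hF ((hmax _).mp ?_)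
    rw [IsLocalRing.mem_maximalIdeal, mem_nonunits_iff, hunitY]
    exact hx
  have hpow : ∀ (χ : OY →+* OB), (maximalIdeal OY).map χ ≤ maximalIdeal OB →
      ∀ (N : ℕ) {x : OY}, x ∈ maximalIdeal OY ^ N → χ x ∈ maximalIdeal OB ^ N := by
    intro χ hχ N x hx
    have h1 : (maximalIdeal OY ^ N).map χ ≤ maximalIdeal OB ^ N := by
      rw [Ideal.map_pow]
      exact Ideal.pow_right_mono hχ N
    exact h1 (Ideal.mem_map_of_mem _ hx)
  -- `ψ` and `Φ` agree on polynomials in `z` with coefficients in `φ(K)`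
  have hpoly : ∀ P : MvPolynomial (Fin d) K,
      ψ (MvPolynomial.eval₂ φ z P) = Φ (MvPolynomial.eval₂ φ z P) := by
    intro P
    change (ψ.comp (MvPolynomial.eval₂Hom φ z)) P = (Φ.comp (MvPolynomial.eval₂Hom φ z)) P
    congr 1
    refine MvPolynomial.ringHom_ext (fun c => ?_) (fun i => ?_)
    · rw [RingHom.comp_apply, RingHom.comp_apply, MvPolynomial.eval₂Hom_C]
      apply eB.injective
      rw [hψc, hΦ, hφ, MvPowerSeries.subst_C]
    · rw [RingHom.comp_apply, RingHom.comp_apply, MvPolynomial.eval₂Hom_X']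
      apply eB.injective
      rw [hψz, hΦ, hz, MvPowerSeries.subst_X hFs]
  -- the polynomial truncations of `eY a` approximate `a` to every order
  have heval : ∀ P : MvPolynomial (Fin d) K,
      eY.symm (P : MvPowerSeries (Fin d) K) = MvPolynomial.eval₂ φ z P := by
    intro P
    change (eY.symm.toRingHom.comp MvPolynomial.coeToMvPowerSeries.ringHom) P =
      MvPolynomial.eval₂Hom φ z P
    congr 1
    refine MvPolynomial.ringHom_ext (fun c => ?_) (fun i => ?_)
    · rw [RingHom.comp_apply, MvPolynomial.coeToMvPowerSeries.ringHom_apply, MvPolynomial.coe_C,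
        MvPolynomial.eval₂Hom_C]
      apply eY.injective
      change eY (eY.symm _) = _
      rw [RingEquiv.apply_symm_apply, hφ]
    · rw [RingHom.comp_apply, MvPolynomial.coeToMvPowerSeries.ringHom_apply, MvPolynomial.coe_X,
        MvPolynomial.eval₂Hom_X']
      apply eY.injective
      change eY (eY.symm _) = _
      rw [RingEquiv.apply_symm_apply, hz]
  rw [← sub_eq_zero]
  refine eq_zero_of_forall_mem_pow (maximalIdeal OB) fun N => ?_
  set P := MvPowerSeries.truncTotal N (eY a) with hP
  have hr : a - MvPolynomial.eval₂ φ z P ∈ maximalIdeal OY ^ N := by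
    rw [← heval, ← eY.symm_apply_apply a, ← map_sub]
    refine happrox N _ fun x hx => ?_
    rw [map_sub, MvPolynomial.coeff_coe, hP, MvPowerSeries.coeff_truncTotal _ hx, sub_self]
  have e : ψ a - Φ a = ψ (a - MvPolynomial.eval₂ φ z P) - Φ (a - MvPolynomial.eval₂ φ z P) := by
    rw [map_sub, map_sub, hpoly]; ring
  rw [e]
  exact Ideal.sub_mem _ (hpow ψ hψ N hr) (hpow Φ hΦloc N hr)

/-! ## Two more facts on stalk maps -/

/-- **Stalk maps preserve constants**: along `g : X → Y` over `Spec k`, the constant `a` at `g x`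
goes to the constant `a` at `x`. [folklore] -/
theorem stalkMap_const {k : Type u} [Field k] {X Y : Scheme.{u}} (g : X ⟶ Y) (f : Y ⟶ Spec (.of k))
    (x : X) (a : k) :
    (g.stalkMap x).hom ((Y.presheaf.germ ⊤ (g x) trivial).hom (f.appTop.hom ((Scheme.ΓSpecIso (.of k)).inv.hom a))) =
      (X.presheaf.germ ⊤ x trivial).hom ((g ≫ f).appTop.hom ((Scheme.ΓSpecIso (.of k)).inv.hom a)) := by
  rw [Scheme.Hom.comp_appTop, CommRingCat.comp_apply]
  exact Scheme.Hom.germ_stalkMap_apply g ⊤ x trivial _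

/-- The completed stalk map is a local homomorphism: it maps `𝔪̂_{Y, g x}` into `𝔪̂_{X, x}`. [folklore] -/
theorem map_maximalIdeal_completedStalkMap_le {X Y : Scheme.{u}} (g : X ⟶ Y) (x : X)
    [IsNoetherianRing (Y.presheaf.stalk (g x))] [IsNoetherianRing (X.presheaf.stalk x)] :
    (maximalIdeal (AdicCompletion (maximalIdeal (Y.presheaf.stalk (g x))) (Y.presheaf.stalk (g x)))).map
        (DeJong1996.completedStalkMap g x) ≤
      maximalIdeal (AdicCompletion (maximalIdeal (X.presheaf.stalk x)) (X.presheaf.stalk x)) := by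
  rw [AdicCompletion.maximalIdeal_eq_map, Ideal.map_map, Ideal.map_le_iff_le_comap]
  intro a ha
  rw [Ideal.mem_comap, RingHom.comp_apply]
  change DeJong1996.completedStalkMap g x (AdicCompletion.of _ _ a) ∈ _
  rw [DeJong1996.completedStalkMap_of, AdicCompletion.maximalIdeal_eq_map]
  exact Ideal.mem_map_of_mem _ (DeJong1996.map_maximalIdeal_stalkMap_le g x (Ideal.mem_map_of_mem _ ha))

/-! ## Registered anchor of this helper file -/

/-- Registered anchor (`stub_formalChart_cohen`, helper 1/3 of `stub_formalChart`): Cohen coordinates linear over a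
field of representatives (`exists_ringEquiv_adicCompletion_mvPowerSeries_linear`, at `Type`).
[cite: Matsumura1987, Thm. 29.7] -/
theorem stub_formalChart_cohen : ∀ (B : Type) [CommRing B] [IsRegularLocalRing B] {K : Type} [Field K] (φ : K →+* B), Function.Surjective ((IsLocalRing.residue B).comp φ) → ∀ {d : ℕ} (z : Fin d → B), Ideal.span (Set.range z) = IsLocalRing.maximalIdeal B → ringKrullDim B = d → ∃ e : AdicCompletion (IsLocalRing.maximalIdeal B) B ≃+* MvPowerSeries (Fin d) K, (∀ i, e (algebraMap B (AdicCompletion (IsLocalRing.maximalIdeal B) B) (z i)) = MvPowerSeries.X i) ∧ (∀ a, e (algebraMap B (AdicCompletion (IsLocalRing.maximalIdeal B) B) (φ a)) = MvPowerSeries.C a) ∧ ∀ (N : ℕ) (G : MvPowerSeries (Fin d) K), (∀ x : Fin d →₀ ℕ, x.degree < N → MvPowerSeries.coeff x G = 0) → e.symm G ∈ IsLocalRing.maximalIdeal (AdicCompletion (IsLocalRing.maximalIdeal B) B) ^ N :=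
  fun B _ _ _ _ φ hφ _ z hz hd => exists_ringEquiv_adicCompletion_mvPowerSeries_linear B φ hφ z hz hd

end Summit.ResolutionOfSingularities.ResolutionOfSingularities.Theorems

end
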